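import Literature.Geometry.Symplectic.PositivityOfIntersectionsLocalProofs

/-!
# Stub `stub_factPositivity` of line `cross-cap-laurent` (crux `GromovRecognitionRelEnd`,
item stmt-SmoothPoincare4-11009): the vendored fact F3 (positivity of intersections, local index
form with a leaf coordinate) is now PROVED in the Literature tree
(`Literature.Geometry.Symplectic.positivityOfIntersections_leafCoordinate_holds`); the stub is
discharged by that theorem.
-/

-- the prescribed namespace `Summit.<P>.<Sub>.…` duplicates `SmoothPoincare4` (P = Sub)
set_option linter.dupNamespace false

namespace Summit.SmoothPoincare4.SmoothPoincare4.Theorems.GromovRecognitionRelEnd.CrossCapLaurent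

/-- **Stub F3 (registered `stub_factPositivity`)**: positivity of intersections with a leaf
coordinate, discharged by the Literature proof. -/
theorem stub_factPositivity : Literature.Geometry.Symplectic.positivityOfIntersections_leafCoordinate :=
  Literature.Geometry.Symplectic.positivityOfIntersections_leafCoordinate_holds

end Summit.SmoothPoincare4.SmoothPoincare4.Theorems.GromovRecognitionRelEnd.CrossCapLaurent
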